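import Summits.FinalStateConjecture.FinalStateConjecture.Theorems.SwallowTheDatumUniversalWitnessFamilySheetLine
import HarnessLib

/-!
# Route item `SwallowTheDatum.SheetShieldedSettles` (stmt-FinalStateConjecture-15428, the S-side of line `Sketch`) —
# REDUCTION TO THE ROUTE ITEMS `MGHDExists` (9937) AND `SubdataDevelopmentsEmbed` (10053)

Continuation lead c2 of line `Sketch` (crux 10051), 2026-08-16.  Since route rev 9 the S-side of the line is the crux item
`SheetShieldedSettles`: an admissible datum which pulls back, along an open embedding of the OPEN exterior sheet of the isotropic
Schwarzschild slice with injective differentials and co-compact far zones, EXACTLY to the time-symmetric Schwarzschild exterior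
data has a maximal vacuum Cauchy development and is settled in EVERY maximal development (complete `𝓘⁺`, exhaustive sub-extremal
`N = 1` decomposition of the self-determined exterior).  Its `∃`-MGHD conjunct is `MGHDExists` applied to the datum, and its `∀`-MGHD
conjunct is the LANDED `settlesInEveryMGHD_ofSheet` (`Theorems/SwallowTheDatumUniversalWitnessFamilySheetLine.lean`: six landed S-side
stubs + `settles_core` + `SubdataDevelopmentsEmbed` specialised to the sheet chart), whose hypothesis is the item's shield clause
verbatim.  Hence `MGHDExists → SubdataDevelopmentsEmbed → SheetShieldedSettles`, sorry-free; CONDITIONAL (credits nothing by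
itself); it displays exactly what item 15428 owes: the two route items.
-/

-- `Summit.<Summit>.<Problem>` is the tree's mandated summit-side namespace (CONVENTIONS §2); for this
-- single-conjunct summit the two coincide, so the duplicate is deliberate.
set_option linter.dupNamespace false

noncomputable section

namespace Summit.FinalStateConjecture.FinalStateConjecture.Theorems.SwallowTheDatum.UniversalWitnessFamily.SheetLine

open scoped Manifold ContDiff Topology
open Set Filter Function Literature.Geometry.Lorentzian
open Summit.FinalStateConjecture.FinalStateConjecture.Theses.SwallowTheDatum
  (MGHDExists SubdataDevelopmentsEmbed SheetShieldedSettles)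

/-- **Sheet-shielded admissible data settle, given the two route items** (`MGHDExists`, stmt-9937, for the `∃`-MGHD conjunct;
`SubdataDevelopmentsEmbed`, stmt-10053, through the landed `settlesInEveryMGHD_ofSheet` for the `∀`-MGHD conjunct).
[cite: ChoquetBruhatGeroch1969CMP, Thm. 3] -/
theorem sheetShieldedSettles_of_mghdExists_of_subdataDevelopmentsEmbed :
    MGHDExists → SubdataDevelopmentsEmbed → SheetShieldedSettles :=
  fun hM hE X _ _ _ _ _ _ D hD hsh ↦
    ⟨hM X D hD, fun 𝒟 hmax ↦ settlesInEveryMGHD_ofSheet hE X D hsh 𝒟 hmax⟩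

end Summit.FinalStateConjecture.FinalStateConjecture.Theorems.SwallowTheDatum.UniversalWitnessFamily.SheetLine

end
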